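import Mathlib
import HarnessLib
import HarnessLib.Audit
import Summits.CriticalPhenomena.Statement
import Literature.Analysis.FunctionSpaces.PoissonPointProcess
import Literature.Probability.RandomPlanarGeometry.HexSAW
import Literature.Probability.RandomPlanarGeometry.ChordalCurveFamily
import Literature.Probability.RandomPlanarGeometry.ConformalRestrictionProofs
import HarnessLib.Audit.Status.Attr

/-!
Route: SAWPoissonHoneycomb

DORMANT since 2026-08-23T14:44:44Z (reconciler: no traction for 6 d (last activity item-evidence-added at 2026-08-17T12:42:23Z); parked, not closed — `ledger route dormant route-CriticalPhenomena-SAWPoissonHoneycomb --off` to reactivate) — unstaffed, not closed; items shared with open routes are served there. `ledger route dormant <id> --off` reactivates.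

# Route SAWPoissonHoneycomb — conformal maps are density gradients — the annealed critical SAW on
the Poisson honeycomb is SLE(8/3) once it is blind to smooth density changes (identification half;
the transfer to δℤ² is the bridge crux PVTransfer and the sibling route SAWPoissonSubstrate)

It suffices to show X₁ = (PV) ∧ (PV ⇒ conjunct) [card poisson-honeycomb-density-gradient;
IDENTIFICATION HALF after the crux-cap
route-choice split of 2026-08-16 — the transfer half (PV) ∧ (U) is now route SAWPoissonSubstrate].
(PV) PVConvergence: the ANNEALED
critical self-avoiding walk on the POISSON HONEYCOMB — the Voronoi graph (a.s. trivalent, isotropic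
in law) of a Poisson process of
intensity δ⁻² on ℂ, weight x_c^(#vertices) with x_c = 1/μ_PV the quenched connective constant, walk
between the domain vertices
nearest to a and b, environment averaged — converges in law on CurveClass ℂ, in every Dobrushin
domain, to chordal SLE_(8/3).
(PV ⇒ conjunct) PVTransfer: that annealed limit theorem suffices for the δℤ² statement — the bridge
crux whose content is
substrate universality (its refutable strengthening SubstrateUniversality,
stmt-CriticalPhenomena-6937, and the two-ε transfer
live in the sibling route). (PV) is reached crux-first: conformal covariance of every subsequential
limit is EXACT Poisson
transport (mapping theorem) + MetricBlindness (Benjamini–Schramm flips) + DensityUniversality;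
restriction is exact environment by
environment and passes to the annealed limit under QuenchedLimit; PVTightSimple supplies compactness
and simplicity; the tree's
Lawler–Schramm–Werner characterisation in hull form (LSWHullCharacterisation, candidate proofs
attached) identifies SLE_(8/3); the
whole identification argument is ONE typed item PVLimitIdentification (it absorbs the restriction
passage — the separately typed
PVRestriction of rev ≤ 3 was inert, see History — and the old glue PVIdentification). All
Poisson–Voronoi objects are typed
inline over Literature.Analysis.FunctionSpaces.IsPoissonPointProcess and the embedded-SAW layer
Literature.Probability.RandomPlanarGeometry.SAW.embLaw (V := ℂ, emb := id, Voronoi adjacency =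
"nearest-site triples sharing two
sites"); a Poisson functor Pois (any assignment ν ↦ PPP(ν) law, unique by Rényi) is the leading
hypothesis of every item.
Lean: `(∀ (Pois : MeasureTheory.Measure ℂ → MeasureTheory.Measure
(Literature.Analysis.FunctionSpaces.PointConfig ℂ)), (∀ ν : MeasureTheory.Measure ℂ,
MeasureTheory.IsLocallyFiniteMeasure ν → (∀ z : ℂ, ν {z} = 0) →
Literature.Analysis.FunctionSpaces.IsPoissonPointProcess ν (Pois ν)) → let S :
Literature.Analysis.FunctionSpaces.PointConfig ℂ → ℂ → Set ℂ := fun ω c => (ω : Set ℂ) ∩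
Metric.sphere c (Metric.infDist c (ω : Set ℂ)); let vor :
Literature.Analysis.FunctionSpaces.PointConfig ℂ → SimpleGraph ℂ := fun ω => SimpleGraph.fromRel fun
c c' => 3 ≤ (S ω c).encard ∧ 3 ≤ (S ω c').encard ∧ (S ω c ∩ S ω c').encard = 2; let μ : ENNReal :=
essSup (fun ω => Filter.limsup (fun n : ℕ => (⨆ c : Metric.closedBall (0 : ℂ) 1,
(Literature.Probability.RandomPlanarGeometry.SAW.sawCount (vor ω) (c : ℂ) n : ENNReal)) ^ (1 / (n :
ℝ))) Filter.atTop) (Pois MeasureTheory.volume); let xc : ℝ := (μ.toReal)⁻¹; let near :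
Literature.Analysis.FunctionSpaces.PointConfig ℂ → Set ℂ → ℂ → ℂ := fun ω Ω z => Classical.epsilon
fun v : ℂ => v ∈ Literature.Probability.RandomPlanarGeometry.SAW.embMeshDomain (vor ω) id Ω 1 ∧ ∀ w
∈ Literature.Probability.RandomPlanarGeometry.SAW.embMeshDomain (vor ω) id Ω 1, dist v z ≤ dist w z;
let intens : (ℂ → ℝ) → ℝ → MeasureTheory.Measure ℂ := fun ρ δ => ENNReal.ofReal (δ⁻¹ ^ 2) •
MeasureTheory.volume.withDensity fun z => ENNReal.ofReal (ρ z); let qlaw :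
Literature.Probability.RandomPlanarGeometry.DobrushinDomain →
Literature.Analysis.FunctionSpaces.PointConfig ℂ → MeasureTheory.Measure
(Literature.Probability.RandomPlanarGeometry.CurveClass ℂ) := fun D ω =>
(Literature.Probability.RandomPlanarGeometry.SAW.embLaw (vor ω) id D.carrier 1 xc (near ω D.carrier
(D.pt 0)) (near ω D.carrier (D.pt 1))).map fun γ => γ.curve; let Q : (ℂ → ℝ) →
Literature.Probability.RandomPlanarGeometry.DobrushinDomain → ℝ → MeasureTheory.Measure
(Literature.Probability.RandomPlanarGeometry.CurveClass ℂ) := fun ρ D δ => (Pois (intens ρ δ)).bind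
(qlaw D); ∀ D : Literature.Probability.RandomPlanarGeometry.DobrushinDomain, ∃ Γ : (NNReal → ℝ) →
Literature.Probability.RandomPlanarGeometry.CurveClass ℂ,
Literature.Probability.RandomPlanarGeometry.IsSLECurve ((8 : NNReal) / 3) D Γ ∧
Literature.Probability.RandomPlanarGeometry.TendstoLaw (fun (_ : ℝ) (x :
Literature.Probability.RandomPlanarGeometry.CurveClass ℂ) => x) (Q (fun _ => 1) D) Γ
Literature.Probability.Process.preWienerMeasure) ∧ ((∀ (Pois : MeasureTheory.Measure ℂ →
MeasureTheory.Measure (Literature.Analysis.FunctionSpaces.PointConfig ℂ)), (∀ ν :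
MeasureTheory.Measure ℂ, MeasureTheory.IsLocallyFiniteMeasure ν → (∀ z : ℂ, ν {z} = 0) →
Literature.Analysis.FunctionSpaces.IsPoissonPointProcess ν (Pois ν)) → let S :
Literature.Analysis.FunctionSpaces.PointConfig ℂ → ℂ → Set ℂ := fun ω c => (ω : Set ℂ) ∩
Metric.sphere c (Metric.infDist c (ω : Set ℂ)); let vor :
Literature.Analysis.FunctionSpaces.PointConfig ℂ → SimpleGraph ℂ := fun ω => SimpleGraph.fromRel fun
c c' => 3 ≤ (S ω c).encard ∧ 3 ≤ (S ω c').encard ∧ (S ω c ∩ S ω c').encard = 2; let μ : ENNReal :=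
essSup (fun ω => Filter.limsup (fun n : ℕ => (⨆ c : Metric.closedBall (0 : ℂ) 1,
(Literature.Probability.RandomPlanarGeometry.SAW.sawCount (vor ω) (c : ℂ) n : ENNReal)) ^ (1 / (n :
ℝ))) Filter.atTop) (Pois MeasureTheory.volume); let xc : ℝ := (μ.toReal)⁻¹; let near :
Literature.Analysis.FunctionSpaces.PointConfig ℂ → Set ℂ → ℂ → ℂ := fun ω Ω z => Classical.epsilon
fun v : ℂ => v ∈ Literature.Probability.RandomPlanarGeometry.SAW.embMeshDomain (vor ω) id Ω 1 ∧ ∀ w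
∈ Literature.Probability.RandomPlanarGeometry.SAW.embMeshDomain (vor ω) id Ω 1, dist v z ≤ dist w z;
let intens : (ℂ → ℝ) → ℝ → MeasureTheory.Measure ℂ := fun ρ δ => ENNReal.ofReal (δ⁻¹ ^ 2) •
MeasureTheory.volume.withDensity fun z => ENNReal.ofReal (ρ z); let qlaw :
Literature.Probability.RandomPlanarGeometry.DobrushinDomain →
Literature.Analysis.FunctionSpaces.PointConfig ℂ → MeasureTheory.Measure
(Literature.Probability.RandomPlanarGeometry.CurveClass ℂ) := fun D ω =>
(Literature.Probability.RandomPlanarGeometry.SAW.embLaw (vor ω) id D.carrier 1 xc (near ω D.carrier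
(D.pt 0)) (near ω D.carrier (D.pt 1))).map fun γ => γ.curve; let Q : (ℂ → ℝ) →
Literature.Probability.RandomPlanarGeometry.DobrushinDomain → ℝ → MeasureTheory.Measure
(Literature.Probability.RandomPlanarGeometry.CurveClass ℂ) := fun ρ D δ => (Pois (intens ρ δ)).bind
(qlaw D); ∀ D : Literature.Probability.RandomPlanarGeometry.DobrushinDomain, ∃ Γ : (NNReal → ℝ) →
Literature.Probability.RandomPlanarGeometry.CurveClass ℂ,
Literature.Probability.RandomPlanarGeometry.IsSLECurve ((8 : NNReal) / 3) D Γ ∧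
Literature.Probability.RandomPlanarGeometry.TendstoLaw (fun (_ : ℝ) (x :
Literature.Probability.RandomPlanarGeometry.CurveClass ℂ) => x) (Q (fun _ => 1) D) Γ
Literature.Probability.Process.preWienerMeasure) → SAWScalingLimit)`

## Assembly
closes (7 binders, all cruxes): DensityUniversality → QuenchedLimit → PVTightSimple →
MetricBlindness → LSWHullCharacterisation →
PVLimitIdentification → PVTransfer → SAWScalingLimit, proof `hPT (hId hLSW hDU hQ hT hMB)` —
PVLimitIdentification's antecedents are
the four disorder/geometry cruxes and the hull characterisation (written out), its conclusion is
PVConvergence written out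
(definitionally the support item PVConvergence, stmt-CriticalPhenomena-6943, shared with
SAWPoissonSubstrate where it is a crux), and
PVTransfer carries PVConvergence to the conjunct. No named unproved Literature fact is a hypothesis:
LawlerSchrammWerner2003(_unique)_holds, IsSLECurve.map_eq_holds,
existsUnique_isPoissonPointProcess_holds and multivariateMecke_holds
are proved in the tree. The Assembly item is restated to the same seven-binder frame (it is not a
hypothesis of `closes`; pure logic: `fun hDU hQ hT hMB hLSW hId hPT => hPT (hId hLSW hDU hQ hT
hMB)`).

Rationale: WHY THIS LINE. Benjamini–Schramm (BenjaminiSchramm1998; BollobasRiordan2006 book pp. 258–259, 264: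
"for random Voronoi percolation,
conformal invariance is equivalent to density invariance", expected number of conformal defects
bounded in 2D) turned conformal
invariance of a Poisson–Voronoi model into ONE universality statement about smooth intensity
changes, but percolation on that
substrate has no identification principle; the critical polymer has one — restriction is an identity
on every graph
(LawlerSchrammWerner2004SAW §3.4.5) and restriction + conformal covariance + simple curves ⇒
SLE_(8/3) is PROVED in the tree
(Literature.Probability.RandomPlanarGeometry.LawlerSchrammWerner2003_holds / _unique_holds). So on
the Poisson honeycomb "conformal
covariance" of the polymer is exact bookkeeping of the Poisson process (Kingman1993 mapping theorem;
Moser transport of densities)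
plus two disorder statements: DensityUniversality (a critical polymer cannot feel a smooth density
gradient of its substrate:
criticality x_c is density-free because the graph law is scale-free) and QuenchedLimit (the
environment averages out: forced on us
because annealing does not commute with conditioning, E[X/Y] ≠ E[X]/E[Y]). Imported areas:
stochastic geometry / Poisson–Voronoi
tessellations (BS98, Tassion2016, AhlbergEtAl2016), disorder-relevance heuristics for topological
disorder (BarghathiVojta2014:
Voronoi coordination fluctuations decay like L^(-3/2), criterion (d+1)ν > 2, met by ν = 3/4),
quasiconformal/Moser transport. What no
prior route does: SAWConfRestriction/SAWRestrictionRigidity keep ℤ² and must CREATE rotations;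
SAWHexUniversality/SAWParafermion buy
conformal structure with integrability; SAWQuantumGravity with LQG/KPZ; here SO(2) and dilations are
exact in law, no observable and
no LQG object is used. Since the split (rev 4) this route carries only the IDENTIFICATION of the
annealed Poisson-honeycomb limit plus
the implicational bridge PVTransfer; the equality-of-laws transfer SubstrateUniversality is the
sibling route SAWPoissonSubstrate.

RANKED CRUXES. #2 DensityUniversality (crux) — (DU, card r2) for every Dobrushin domain D and every
density ρ that is C² and positive on
D, equal to 1 off D and integrable on D (this class contains the conformal factors |ψ′|² of
MetricBlindness), the annealed critical
Poisson-honeycomb SAW laws in D with intensities δ⁻²ρ dA and δ⁻² dA are asymptotically equal on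
bounded continuous test functions as
δ → 0+ (same fugacity x_c = 1/μ_PV: criticality is density-free). [difficulty: open-problem] (why it
might fail: 2D polymer + point
disorder is naively Harris-relevant (dν = 3/2 < 2); DU bets on the anticorrelated Voronoi disorder
((d+1)ν = 9/4 > 2,
BarghathiVojta2014) and on annealing; a density GRADIENT couples coherently to the local length
unit; |ψ′|² degenerates at rough ∂D.)
[BenjaminiSchramm1998, book:bollobas2006-percolation p.264, BarghathiVojta2014,
doi:10.1007/s00440-013-0520-1]
#4 QuenchedLimit (crux) — (quenched = annealed asymptotically) for every Dobrushin domain D, bounded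
continuous f and ε > 0, the
probability (under the Poisson law of intensity δ⁻²) that the QUENCHED test integral ∫ f dP^ω_D
differs from the annealed one
∫ f dQ_D,δ by at least ε tends to 0 as δ → 0+; needed because restriction is exact only environment
by environment.
[difficulty: XL] (why it might fail: d = 2 polymers in random media may keep environment dependence
in the limit; the
Efron–Stein influence sum diverges (Σ P(visit cell)² ≍ δ^(-2/3)), so concentration needs chaos-type
input beyond AGMT.)
[AhlbergEtAl2016, doi:10.1007/s00440-013-0520-1, BenjaminiKalaiSchramm1999, LastPenrose2017]
#5 PVTightSimple (crux) — (card r4) for every Dobrushin domain: total mass of Q_D,δ → 1, EVENTUAL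
tightness on CurveClass ℂ along
δ → 0+, and every subsequential weak limit that is a probability measure is carried by simple curves
from a to b meeting ∂D only at
a, b. [difficulty: XL] (why it might fail: needs annulus-crossing/arm bounds for the x_c-SAW on a
random trivalent graph; whether
1/μ_PV is critical for CONFINED walks on a random graph is open; eventual form only, cf. stmt-0772.)
[KemppainenSmirnov2017,
AizenmanBurchard1999, DuminilCopinHammond2013, MadrasSlade1993]
#6 MetricBlindness (crux) — (card T1–T2 + F) for Dobrushin D, D′, a conformal equivalence g : D → D′
with boundary values a ↦ a′,
b ↦ b′ and any continuous Φ agreeing with g on D, the Φ-push-forward of the annealed law in D at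
density 1 and the annealed law in
D′ with the transported density ρ_g = |(g⁻¹)′|² (1 outside) are asymptotically equal: the image
process IS Poisson of intensity
δ⁻²ρ_g (mapping theorem), only the Voronoi RULE differs, by O(1) expected flips. [difficulty: L]
(why it might fail: for the polymer
LAW the O(1) conformal flips and the mismatched boundary layer of outside points must be missed:
needs a uniform one-point bound
P(SAW visits a given cell) → 0 and endpoint robustness near a, b.) [BenjaminiSchramm1998,
book:bollobas2006-percolation
pp.258-259, Kingman1993, KennedyLawler2013]
#7 PVLimitIdentification (crux, glue WITH content; new at rev 4) — LSWHullCharacterisation (written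
out) → DensityUniversality →
QuenchedLimit → PVTightSimple → MetricBlindness → PVConvergence (written out): fix a subsequence
along which the unit-disc laws
converge (tightness); for any D and Riemann map g : disc → D with Carathéodory extension Φ,
MetricBlindness + DensityUniversality
(applied in D to ρ_g, which is C², positive, 1 outside, of integral area(disc)) give convergence of
Q_D along the SAME subsequence
to Φ_*(limit), so D ↦ lim Q_D is a chordal, conformally covariant family; hull restriction of that
family is obtained from the
EXACT quenched restriction identity on induced Voronoi subgraphs (LSW04 §3.4.5), commuted with the
environment average by
QuenchedLimit and passed to the limit by a hull SANDWICH (ε-enlarged / shrunk hull subdomains +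
portmanteau; NOT by asking the
staying event to be a continuity set — that formulation, the rev ≤ 3 item PVRestriction, was inert:
refuter g42-21); PVTightSimple
gives simplicity and IsChordal; the hull characterisation identifies SLE_(8/3); uniqueness of the
SLE law
(IsSLECurve.map_eq_holds) upgrades subsequential to full convergence. [difficulty: L–XL] (why it
might fail: the restriction
passage needs uniform control of P_δ[range ⊆ cl D″] across the ε-sandwich, i.e. continuity of
hull-avoidance probabilities of the
LIMIT, available only after simplicity; DU must be applied to ρ_g = |(g⁻¹)′|², unbounded near a
rough ∂D.)
[LawlerSchrammWerner2003Restriction, LawlerSchrammWerner2004SAW §3.4.5, Kingman1993,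
BenjaminiSchramm1998,
Literature.Probability.RandomPlanarGeometry.IsSLECurve.map_eq_holds]
#8 PVTransfer (crux, bridge; new at rev 4) — PVConvergence (written out) → SAWScalingLimit: the
annealed Poisson-honeycomb limit
theorem suffices for the δℤ² conjunct. Content = substrate universality given (PV); as an
implication INTO the conjunct it is
irrefutable short of refuting the conjunct (the HexTransfer.Negative §2 accounting applies
verbatim), so its refutable strengthening
SubstrateUniversality ∧ two-ε is staffed in the sibling route SAWPoissonSubstrate, and a proof there
closes this item in two lines.
[difficulty: open-problem] (why it might fail: it cannot be refuted short of ¬SAWScalingLimit, but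
it can fail to be PROVABLE by
any substrate-blind argument: Beffara's embedding-modulus caveat for ℤ² sits inside it in full.)
[LawlerSchrammWerner2004SAW,
Beffara2008, GlazmanManolescu2019, KennedyLawler2013, route-CriticalPhenomena-SAWPoissonSubstrate]
#9 LSWHullCharacterisation (auto-crux since 2026-08-16, provable-now; candidate proofs LSWHull.lean
/ SPHHull.lean attached, rc 0,
standard axioms) — hull form of the Lawler–Schramm–Werner characterisation in the tree's vocabulary.
[LawlerSchrammWerner2003Restriction,
Literature.Probability.RandomPlanarGeometry.LawlerSchrammWerner2003_holds,
LawlerSchrammWerner2003_unique_holds]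
Support (not a binder): PVConvergence (stmt-6943) — the conclusion node of PVLimitIdentification,
shared with SAWPoissonSubstrate.

TWO-LAYER PLAN. DensityUniversality ⇐ DUBulk → DUBoundary → DensityUniversality: DUBulk = densities
C² with two-sided bounds on all
of ℂ (Moser transport to a slowly varying ELLIPSE rule on a homogeneous process + quasiconformal
homogenisation, seams of vanishing
defect density in the window δ ≪ ℓ ≪ δ^(1/3)); DUBoundary = removal of the boundary layers where
|ψ′|² → 0 or ∞ at a rough ∂D.
PVTightSimple ⇐ PVArmBound (annealed annulus-crossing bound of Kemppainen–Smirnov G2 type on the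
isotropic random graph) →
PVNoTouch → PVTightSimple. QuenchedLimit ⇐ influence bound (one-cell resampling changes the quenched
law by ≤ P(visit)) → variance
decay via Poisson chaos / OSSS-type inequality on stopping sets (Last–Peccati) → QuenchedLimit.
PVLimitIdentification ⇐
PVHullRestriction (the sandwich restriction passage for joint subsequential limits, correctly typed
with ε-enlarged hulls) →
PVCovariantFamily (subsequence transport: D ↦ lim Q_D is a well-defined chordal conformally
covariant family) →
PVLimitIdentification. Nothing here is filed now.

KILL CRITERIA. ¬DensityUniversality (a smooth density change that shifts the annealed law:
log-periodicity in δ or a macroscopic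
drift down the gradient) closes the route (close --reason refuted:DensityUniversality): the Poisson
honeycomb is then not a
conformally covariant regularisation. ¬QuenchedLimit (environment dependence surviving in the limit)
closes it likewise.
¬MetricBlindness would contradict the BS98 defect count and closes the route. ¬PVTightSimple as
typed most plausibly means 1/μ_PV
is not critical for confined walks: PIVOT by restating x_c as the bridge/box growth rate (route edit
--restate), not a close.
¬PVLimitIdentification (the four inputs hold but the limit is not SLE_(8/3)) would most plausibly
expose a mis-typed input (repair
by restate); PVTransfer cannot be refuted short of ¬SAWScalingLimit; ¬SubstrateUniversality in the
sibling with PVConvergence proved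
here is non-universality ℤ² vs Poisson honeycomb — it does not close THIS route but makes PVTransfer
hopeless, so retire
(close --as retired) unless another transfer technology is in sight.

NOT DECOMPOSED YET. Kernel measurability of ω ↦ quenched law and a.s. constancy / positivity of μ_PV
(bookkeeping lemmas that ride
with --supports; if measurability failed the bind would be the zero measure and PVTightSimple's mass
→ 1 clause would be FALSE, so
no PV item can close vacuously — the route-review refuter recommends filing KernelAEMeasurable once
as a support item; left to the
tenure planner so as not to grow the item list during a cap repair); the Poisson mapping theorem for
conformal bijections (Kingman
§2.3); the exact quenched restriction and domain-Markov identities on induced Voronoi subgraphs and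
the hull sandwich (inside
PVLimitIdentification, see TWO-LAYER PLAN); endpoint conventions and their robustness; the flip-set
formalism behind
MetricBlindness; Variant H of the card (hyperbolic intensity + hyperbolic Voronoi rule: exact Möbius
covariance at finite mesh) —
a separate route only if MetricBlindness stalls. No Target item is filed (X₁'s first conjunct is the
support decl PVConvergence,
derived by PVLimitIdentification; its second is the crux PVTransfer).

CHEAPEST FALSIFIER. (i) γ, ν of the Poisson-honeycomb SAW by exact enumeration / flatPERM on a few
hundred sampled environments (one
batched kit job, not run in this planner seat): anything but ν = 3/4, γ = 43/32 kills PVTransfer's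
bearing on ℤ² at once. (ii) DU
test in the disc: left-passage probabilities of the annealed walk at interior points, density 1
versus the pull-back density |ψ′|²
of a non-Möbius conformal map (Schramm's SLE_(8/3) left-passage formula as referee); a discrepancy
stable under δ → δ/2 refutes
DensityUniversality; with a disc automorphism instead the agreement must be exact up to flips (code
check of MetricBlindness).
(iii) Quenched spread: the empirical variance over environments of a crossing-type test integral at
δ, δ/2, δ/4 — no decay refutes
QuenchedLimit. Lookup already done: BR2006 p.259 confirms the O(1) defect count MetricBlindness
relies on.

NUMBERS. μ(ℤ²) ∈ [2.6, 2.7] (LawlerSchrammWerner2004SAW §3.1; ≈ 2.638), x_c(ℤ²) = 1/μ; μ(Hex) =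
√(2+√2) ≈ 1.848
(DuminilCopinSmirnov2012); μ_PV ≤ 2 (a.s. 3-regular graph), so x_c(PV) ≥ 1/2; SAW exponents ν = 3/4,
γ = 43/32 (Nienhuis1982);
restriction exponent 5/8, κ = 8/3 (LawlerSchrammWerner2003Restriction Thm 6.1); Harris counts: dν =
3/2 < 2, (d+1)ν = 9/4 > 2
(BarghathiVojta2014); conformal defects: expected number O(1) in 2D as intensity → ∞
(BenjaminiSchramm1998 via BollobasRiordan2006
p.259); Voronoi vertex density = 2 × site density; line-defect RG eigenvalue for the polymer 1 − x_ε
= 1/3 > 0.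

DEFINITION REQUESTS. D1 `PoissonVoronoiGraph` (topic Literature/Probability/RandomPlanarGeometry):
the Voronoi graph of a locally
finite configuration ω : PointConfig ℂ as a SimpleGraph ℂ with a.s. trivalence, local finiteness,
planarity, measurability of local
events under IsPoissonPointProcess; it replaces the inline `vor` of every item. D2 `PVSAWLaw` (same
topic): the quenched critical
SAW law qlaw D ω, the annealed law Q ρ D δ := (PPP(δ⁻²ρ dA)).bind (qlaw D), and μ_PV, with the
lemmas kernel AEMeasurable, μ_PV a.s.
constant in [1, 2], density/scale-free. Wanted fact (cite): Kingman1993 §2.3 mapping theorem for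
measurable bijections. (Filed at
open by the plancard planner; unchanged by the split.)

Novelty: Searches (2026-08-15): `lit search --hybrid "conformal invariance Voronoi percolation Benjamini
Schramm"` (12 held; read book:bollobas2006-percolation pp.256–268: p.258–259 BS98 = invariance under
conformal change of METRIC at fixed measure, bounded expected defects; p.264 "conformal invariance
is equivalent to density invariance"); `lit search --hybrid "self-avoiding walk Voronoi Delaunay
random lattice"` (15 held, none on SAW on Poisson–Voronoi); remote cascades openalex / s2 / arxiv
(HTTP 429 all day) and zbmath (0 hits) for "self-avoiding walk Voronoi random lattice"; `lit galaxy
search --star all "self-avoiding walks on random lattices"` (1, irrelevant), `--star pdf "Voronoi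
percolation"` (20: AGMT/Tassion/noise-sensitivity lineage, no polymer), `--star pdf "density
invariance"` (12, noise); `lit frontier CriticalPhenomena --since 2020` (30 descendants, none
Poisson–Voronoi + SAW); `lit bridges CriticalPhenomena --cross any` (noise); `ledger idea list`
(this sub: the only Poisson-substrate cards are the four filings consolidated into the spine card);
`ledger negatives` (1 entry, stmt-0772); the spine card's novelty audit
(refuter-novelty-audit-CriticalPhenomena-SAWScalingLimit-9-0: BS98 known in detail, LSW03
conditional theorem; grade new-combination).
Nearest prior art found: BenjaminiSchramm1998 (doi:10.1007/s002200050443) with BollobasRiordan2006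
p.264 — for Voronoi PERCOLATION conformal invariance ⇐ density invariance (open), which is exactly
MetricBlindness + Densi  [refs: 10.1007/s002200050443, book:bollobas2006-percolation, doi:10.1007/s002200050443, BenjaminiSchramm1998, BollobasRiordan2006, AhlbergEtAl2016]

Barriers (technique_class: poisson-voronoi-substrate, density-universality): - technique_class: poisson-voronoi-substrate, density-universality
- Literature.Barriers.CriticalPhenomena.EmbeddingModulusUniqueness: evaded on the Poisson honeycomb
— the annealed law is SO(2)-invariant and a linear image A of the model is the A-ELLIPSE-rule
Voronoi model of another homogeneous Poisson process (a different combinatorial rule), so no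
competing modulus arises; for δℤ² the barrier returns in full inside SubstrateUniversality, where it
belongs, and is not claimed evaded.
- Literature.Barriers.CriticalPhenomena.ScaleCovarianceNotMoebius: not invoked — no "scale +
rotation ⇒ conformal" upgrade; Möbius/conformal covariance comes from EXACT transport of the Poisson
process (mapping theorem) plus the model-specific inputs MetricBlindness and DensityUniversality.
- Literature.Barriers.CriticalPhenomena.SupercriticalSAWSpaceFilling: respected — the fugacity is
x_c = 1/μ_PV exactly and never perturbed; density changes do not touch the fugacity per vertex
because the graph law is scale-free; the residual risk (is 1/μ_q critical for confined walks?) is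
written into PVTightSimple's why-line, and a supercritical reading would show up as loss of
simplicity there.
- Literature.Barriers.CriticalPhenomena.SAWNotKineticallyGrown: inapplicable — Gibbs weights
x_c^(#vertices) on a random graph, nothing is grown.
- Literature.Barriers.CriticalPhenomena.NienhuisWeightsExcludeVertexSAW: inapplicable — no vertex
relation / observable on ℤ² or elsewhere; the bet is symmetry + universa

History (route lifecycle, newest last):
- 2026-08-16T16:41:31Z · AUTO-CRUX (backfill): LSWHullCharacterisation, PVRestriction, PVIdentification, AssemblyViaTransfer — hypotheses of the deciding theorem that nothing in the route derives are cruxes (operator:999:1813213)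
- 2026-08-16T17:11:44Z · rev 4: restated Assembly (stmt-CriticalPhenomena-6946) — route-choice crux-cap SPLIT step 1/2: drop SubstrateUniversality (→ sibling route), AssemblyViaTransfer, PVRestriction (inert), PVIdentification; interim Assemb (planner-rchoice-CriticalPhenomena-SAWPoissonHo-11b4d6dd-0)
- 2026-08-16T17:11:44Z · rev 4: dropped SubstrateUniversality, AssemblyViaTransfer, PVRestriction, PVIdentification — route-choice crux-cap SPLIT step 1/2: drop SubstrateUniversality (→ sibling route), AssemblyViaTransfer, PVRestriction (inert), PVIdentification; interim Assemb (planner-rchoice-CriticalPhenomena-SAWPoissonHo-11b4d6dd-0)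
- 2026-08-16T17:12:13Z · rev 5: restated Assembly (stmt-CriticalPhenomena-16047) — route-choice crux-cap SPLIT step 2/2: add PVLimitIdentification (r7) + PVTransfer (r8), final Assembly frame, crux-only closes with 7 crux binders; thesis/ratio (planner-rchoice-CriticalPhenomena-SAWPoissonHo-11b4d6dd-0)
- 2026-08-23T14:44:44Z · DORMANT — reconciler: no traction for 6 d (last activity item-evidence-added at 2026-08-17T12:42:23Z); parked, not closed — `ledger route dormant route-CriticalPhenomena- (operator:999:1422027)

sub-problem: SAWScalingLimit · status: dormant · opened planner-plancard-CriticalPhenomena-SAWScaling-90c48214-0 2026-08-15T11:55:56Z · rev 7 · ledger route-CriticalPhenomena-SAWPoissonHoneycomb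
GENERATED by the gate from the ledger (D-0016/17). Provers cite these decls: `theorem foo : Summit.CriticalPhenomena.SAWScalingLimit.Theses.SAWPoissonHoneycomb.<Decl> := …` in Summits/CriticalPhenomena/SAWScalingLimit/Theorems/<Name>.lean.
-/

namespace Summit.CriticalPhenomena.SAWScalingLimit.Theses.SAWPoissonHoneycomb

open scoped BigOperators Topology Manifold Classical MeasureTheory ProbabilityTheory Matrix InnerProductSpace ComplexConjugate ContinuousMap
open Filter Set Function TopologicalSpace MeasureTheory

attribute [summit_statement] _root_.SAWScalingLimit

/-- item stmt-CriticalPhenomena-6936 · crux · rank 2 · open · by planner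
why it might fail: 2D polymer + point disorder is naively Harris-relevant (dν = 3/2 < 2); DU bets on the anticorrelated Voronoi disorder ((d+1)ν = 9/4 > 2, BarghathiVojta2014) and on annealing; a density GRADIENT couples coherently to the local length unit; |ψ′|² degenerates at rough ∂D (extra arm estimates).
sources: BenjaminiSchramm1998, book:bollobas2006-percolation p.264, BarghathiVojta2014, doi:10.1007/s00440-013-0520-1, doi:10.1090/S0002-9947-1965-0182927-5
[crux] (DU, card r2) for every Dobrushin domain D and every density ρ that is C² and positive on D,
equal to 1 off D and integrable on D (this class contains the conformal factors |ψ′|² of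
MetricBlindness), the annealed critical Poisson-honeycomb SAW laws in D with intensities δ⁻²ρ dA and
δ⁻² dA are asymptotically equal on bounded continuous test functions as δ → 0+ (same fugacity x_c =
1/μ_PV: criticality is density-free). [difficulty: open-problem] -/
@[route_item "route-CriticalPhenomena-SAWPoissonHoneycomb", crux]
def DensityUniversality : Prop :=
  ∀ (Pois : MeasureTheory.Measure ℂ → MeasureTheory.Measure (Literature.Analysis.FunctionSpaces.PointConfig ℂ)), (∀ ν : MeasureTheory.Measure ℂ, MeasureTheory.IsLocallyFiniteMeasure ν → (∀ z : ℂ, ν {z} = 0) → Literature.Analysis.FunctionSpaces.IsPoissonPointProcess ν (Pois ν)) → let S : Literature.Analysis.FunctionSpaces.PointConfig ℂ → ℂ → Set ℂ := fun ω c => (ω : Set ℂ) ∩ Metric.sphere c (Metric.infDist c (ω : Set ℂ)); let vor : Literature.Analysis.FunctionSpaces.PointConfig ℂ → SimpleGraph ℂ := fun ω => SimpleGraph.fromRel fun c c' => 3 ≤ (S ω c).encard ∧ 3 ≤ (S ω c').encard ∧ (S ω c ∩ S ω c').encard = 2; let μ : ENNReal := essSup (fun ω => Filter.limsup (fun n :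 ℕ => (⨆ c : Metric.closedBall (0 : ℂ) 1, (Literature.Probability.RandomPlanarGeometry.SAW.sawCount (vor ω) (c : ℂ) n : ENNReal)) ^ (1 / (n : ℝ))) Filter.atTop) (Pois MeasureTheory.volume); let xc : ℝ := (μ.toReal)⁻¹; let near : Literature.Analysis.FunctionSpaces.PointConfig ℂ → Set ℂ → ℂ → ℂ := fun ω Ω z => Classical.epsilon fun v : ℂ => v ∈ Literature.Probability.RandomPlanarGeometry.SAW.embMeshDomain (vor ω) id Ω 1 ∧ ∀ w ∈ Literature.Probability.RandomPlanarGeometry.SAW.embMeshDomain (vor ω) id Ω 1, dist v z ≤ dist w z; let intens : (ℂ → ℝ) → ℝ → MeasureTheory.Measure ℂ := fun ρ δ => ENNReal.ofReal (δ⁻¹ ^ 2) • MeasureTheory.volume.withDensity fun z => ENNReal.ofReal (ρ z); let qlaw : Literature.Probability.RandomPlanarGeometry.DobrushinDomain → Literature.Analysis.FunctionSpaces.PointConfig ℂ → MeasureTheory.Measure (Literature.Probability.RandomPlanarGeometry.CurveClass ℂ) := fun D ω => (Literature.Probability.RandomPlanarGeometry.SAW.embLaw (vor ω) id D.carrier 1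 xc (near ω D.carrier (D.pt 0)) (near ω D.carrier (D.pt 1))).map fun γ => γ.curve; let Q : (ℂ → ℝ) → Literature.Probability.RandomPlanarGeometry.DobrushinDomain → ℝ → MeasureTheory.Measure (Literature.Probability.RandomPlanarGeometry.CurveClass ℂ) := fun ρ D δ => (Pois (intens ρ δ)).bind (qlaw D); ∀ (D : Literature.Probability.RandomPlanarGeometry.DobrushinDomain) (ρ : ℂ → ℝ), ContDiffOn ℝ 2 ρ D.carrier → (∀ z ∈ D.carrier, 0 < ρ z) → (∀ z ∉ D.carrier, ρ z = 1) → MeasureTheory.IntegrableOn ρ D.carrier → ∀ f : BoundedContinuousFunction (Literature.Probability.RandomPlanarGeometry.CurveClass ℂ) ℝ, Filter.Tendsto (fun δ => (∫ x, f x ∂(Q ρ D δ)) - ∫ x, f x ∂(Q (fun _ => 1) D δ)) (nhdsWithin 0 (Set.Ioi 0)) (nhds 0)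

/-- item stmt-CriticalPhenomena-6938 · crux · rank 4 · open · by planner
why it might fail: d = 2 polymers in random media may keep environment dependence in the limit (directed polymer: strong disorder at every temperature; Lacoin: quenched ≠ annealed μ on diluted ℤ²); the Efron–Stein influence sum diverges (Σ P(visit cell)² ≍ δ^(-2/3)), so concentration needs chaos-type input beyond AGMT
sources: AhlbergEtAl2016, doi:10.1007/s00440-013-0520-1, BenjaminiKalaiSchramm1999, LastPenrose2017
[crux] (quenched = annealed asymptotically) for every Dobrushin domain D, bounded continuous f and ε
> 0, the probability (under the Poisson law of intensity δ⁻²) that the QUENCHED test integral ∫ f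
dP^ω_D differs from the annealed one ∫ f dQ_D,δ by at least ε tends to 0 as δ → 0+. Needed because
restriction is exact only environment by environment; the AGMT analogue for Voronoi percolation
crossings. [difficulty: XL] -/
@[route_item "route-CriticalPhenomena-SAWPoissonHoneycomb", crux]
def QuenchedLimit : Prop :=
  ∀ (Pois : MeasureTheory.Measure ℂ → MeasureTheory.Measure (Literature.Analysis.FunctionSpaces.PointConfig ℂ)), (∀ ν : MeasureTheory.Measure ℂ, MeasureTheory.IsLocallyFiniteMeasure ν → (∀ z : ℂ, ν {z} = 0) → Literature.Analysis.FunctionSpaces.IsPoissonPointProcess ν (Pois ν)) → let S : Literature.Analysis.FunctionSpaces.PointConfig ℂ → ℂ → Set ℂ := fun ω c => (ω : Set ℂ) ∩ Metric.sphere c (Metric.infDist c (ω : Set ℂ)); let vor : Literature.Analysis.FunctionSpaces.PointConfig ℂ → SimpleGraph ℂ := fun ω => SimpleGraph.fromRel fun c c' => 3 ≤ (S ω c).encard ∧ 3 ≤ (S ω c').encard ∧ (S ω c ∩ S ω c').encard = 2; let μ : ENNReal := essSup (fun ω => Filter.limsup (fun n : ℕ => (⨆ c : Metric.closedBall (0 :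 ℂ) 1, (Literature.Probability.RandomPlanarGeometry.SAW.sawCount (vor ω) (c : ℂ) n : ENNReal)) ^ (1 / (n : ℝ))) Filter.atTop) (Pois MeasureTheory.volume); let xc : ℝ := (μ.toReal)⁻¹; let near : Literature.Analysis.FunctionSpaces.PointConfig ℂ → Set ℂ → ℂ → ℂ := fun ω Ω z => Classical.epsilon fun v : ℂ => v ∈ Literature.Probability.RandomPlanarGeometry.SAW.embMeshDomain (vor ω) id Ω 1 ∧ ∀ w ∈ Literature.Probability.RandomPlanarGeometry.SAW.embMeshDomain (vor ω) id Ω 1, dist v z ≤ dist w z; let intens : (ℂ → ℝ) → ℝ → MeasureTheory.Measure ℂ := fun ρ δ => ENNReal.ofReal (δ⁻¹ ^ 2) • MeasureTheory.volume.withDensity fun z => ENNReal.ofReal (ρ z); let qlaw : Literature.Probability.RandomPlanarGeometry.DobrushinDomain → Literature.Analysis.FunctionSpaces.PointConfig ℂ → MeasureTheory.Measure (Literature.Probability.RandomPlanarGeometry.CurveClass ℂ) := fun D ω => (Literature.Probability.RandomPlanarGeometry.SAW.embLaw (vor ω) id D.carrier 1 xc (near ω D.carrier (D.pt 0)) (near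 ω D.carrier (D.pt 1))).map fun γ => γ.curve; let Q : (ℂ → ℝ) → Literature.Probability.RandomPlanarGeometry.DobrushinDomain → ℝ → MeasureTheory.Measure (Literature.Probability.RandomPlanarGeometry.CurveClass ℂ) := fun ρ D δ => (Pois (intens ρ δ)).bind (qlaw D); ∀ (D : Literature.Probability.RandomPlanarGeometry.DobrushinDomain) (f : BoundedContinuousFunction (Literature.Probability.RandomPlanarGeometry.CurveClass ℂ) ℝ) (ε : ℝ), 0 < ε → Filter.Tendsto (fun δ => Pois (intens (fun _ => 1) δ) {ω | ε ≤ |(∫ x, f x ∂(qlaw D ω)) - ∫ x, f x ∂(Q (fun _ => 1) D δ)|}) (nhdsWithin 0 (Set.Ioi 0)) (nhds 0)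

/-- item stmt-CriticalPhenomena-6939 · crux · rank 5 · open · by planner
why it might fail: Needs annulus-crossing/arm bounds for the x_c-SAW on a random trivalent graph (Kesten unfolding uses lattice reflections, here only in law); whether 1/μ_q is critical for CONFINED walks on a random graph is open (else the limit is geodesic or dense); eventual form only (cf. stmt-0772).
sources: KemppainenSmirnov2017, AizenmanBurchard1999, DuminilCopinHammond2013, MadrasSlade1993, Summit.CriticalPhenomena.SAWScalingLimit.Theorems.SAWParafermionTight_refuted
[crux] (card r4, a-priori package for the annealed Poisson-honeycomb law Q_D,δ at density 1) for
every Dobrushin domain: total mass → 1, EVENTUAL tightness on CurveClass ℂ along δ → 0+ (∀ ε ∃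
compact K, eventually Q(Kᶜ) ≤ ε), and every subsequential weak limit that is a probability measure
is carried by simple curves from a to b meeting ∂D only at a, b. [difficulty: XL] -/
@[route_item "route-CriticalPhenomena-SAWPoissonHoneycomb", crux]
def PVTightSimple : Prop :=
  ∀ (Pois : MeasureTheory.Measure ℂ → MeasureTheory.Measure (Literature.Analysis.FunctionSpaces.PointConfig ℂ)), (∀ ν : MeasureTheory.Measure ℂ, MeasureTheory.IsLocallyFiniteMeasure ν → (∀ z : ℂ, ν {z} = 0) → Literature.Analysis.FunctionSpaces.IsPoissonPointProcess ν (Pois ν)) → let S : Literature.Analysis.FunctionSpaces.PointConfig ℂ → ℂ → Set ℂ := fun ω c => (ω : Set ℂ) ∩ Metric.sphere c (Metric.infDist c (ω : Set ℂ)); let vor : Literature.Analysis.FunctionSpaces.PointConfig ℂ → SimpleGraph ℂ := fun ω => SimpleGraph.fromRel fun c c' => 3 ≤ (S ω c).encard ∧ 3 ≤ (S ω c').encard ∧ (S ω c ∩ S ω c').encard = 2; let μ : ENNReal := essSup (fun ω => Filter.limsup (fun n : ℕ => (⨆ c : Metric.closedBall (0 : ℂ) 1, (Literature.Probability.RandomPlanarGeometry.SAW.sawCount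 (vor ω) (c : ℂ) n : ENNReal)) ^ (1 / (n : ℝ))) Filter.atTop) (Pois MeasureTheory.volume); let xc : ℝ := (μ.toReal)⁻¹; let near : Literature.Analysis.FunctionSpaces.PointConfig ℂ → Set ℂ → ℂ → ℂ := fun ω Ω z => Classical.epsilon fun v : ℂ => v ∈ Literature.Probability.RandomPlanarGeometry.SAW.embMeshDomain (vor ω) id Ω 1 ∧ ∀ w ∈ Literature.Probability.RandomPlanarGeometry.SAW.embMeshDomain (vor ω) id Ω 1, dist v z ≤ dist w z; let intens : (ℂ → ℝ) → ℝ → MeasureTheory.Measure ℂ := fun ρ δ => ENNReal.ofReal (δ⁻¹ ^ 2) • MeasureTheory.volume.withDensity fun z => ENNReal.ofReal (ρ z); let qlaw : Literature.Probability.RandomPlanarGeometry.DobrushinDomain → Literature.Analysis.FunctionSpaces.PointConfig ℂ → MeasureTheory.Measure (Literature.Probability.RandomPlanarGeometry.CurveClass ℂ) := fun D ω => (Literature.Probability.RandomPlanarGeometry.SAW.embLaw (vor ω) id D.carrier 1 xc (near ω D.carrier (D.pt 0)) (near ω D.carrier (D.pt 1))).map fun γ => γ.curve; let Q : (ℂ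 → ℝ) → Literature.Probability.RandomPlanarGeometry.DobrushinDomain → ℝ → MeasureTheory.Measure (Literature.Probability.RandomPlanarGeometry.CurveClass ℂ) := fun ρ D δ => (Pois (intens ρ δ)).bind (qlaw D); ∀ D : Literature.Probability.RandomPlanarGeometry.DobrushinDomain, Filter.Tendsto (fun δ => Q (fun _ => 1) D δ Set.univ) (nhdsWithin 0 (Set.Ioi 0)) (nhds 1) ∧ (∀ ε : ℝ, 0 < ε → ∃ K : Set (Literature.Probability.RandomPlanarGeometry.CurveClass ℂ), IsCompact K ∧ ∀ᶠ δ in nhdsWithin 0 (Set.Ioi 0), Q (fun _ => 1) D δ Kᶜ ≤ ENNReal.ofReal ε) ∧ ∀ (P : MeasureTheory.Measure (Literature.Probability.RandomPlanarGeometry.CurveClass ℂ)) (s : ℕ → ℝ), Filter.Tendsto s Filter.atTop (nhdsWithin 0 (Set.Ioi 0)) → MeasureTheory.IsProbabilityMeasure P → (∀ f : BoundedContinuousFunction (Literature.Probability.RandomPlanarGeometry.CurveClass ℂ) ℝ, Filter.Tendsto (fun n => ∫ x, f x ∂(Q (fun _ => 1) D (s n))) Filter.atTop (nhds (∫ x,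 f x ∂P))) → ∀ᵐ γ ∂P, γ ∈ Literature.Probability.RandomPlanarGeometry.CurveClass.simple ∧ γ.source = D.pt 0 ∧ γ.target = D.pt 1 ∧ γ.range ∩ frontier D.carrier ⊆ {D.pt 0, D.pt 1}

/-- item stmt-CriticalPhenomena-6940 · crux · rank 6 · open · by planner
why it might fail: BS98 control percolation crossings; for the polymer LAW the O(1) expected conformal flips (BR2006 p.259) and the mismatched boundary layer of outside points must be missed: needs a uniform one-point bound P(SAW visits a given cell) → 0 and endpoint robustness near a, b (Kennedy–Lawler).
sources: BenjaminiSchramm1998, book:bollobas2006-percolation pp.258-259, Kingman1993, KennedyLawler2013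
[crux] (card T1–T2 + F: Benjamini–Schramm for the polymer, transport form) for Dobrushin domains D,
D′, a conformal equivalence g : D → D′ with boundary values a ↦ a′, b ↦ b′ and any continuous Φ
agreeing with g on D, the Φ-push-forward of the annealed law in D at density 1 and the annealed law
in D′ with the transported density ρ_g = |(g⁻¹)′|² on D′ (1 outside) are asymptotically equal on
test functions: the image process IS Poisson of intensity δ⁻²ρ_g (mapping theorem), only the Voronoi
RULE differs, by O(1) expected flips. [difficulty: L] -/
@[route_item "route-CriticalPhenomena-SAWPoissonHoneycomb", crux]
def MetricBlindness : Prop :=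
  ∀ (Pois : MeasureTheory.Measure ℂ → MeasureTheory.Measure (Literature.Analysis.FunctionSpaces.PointConfig ℂ)), (∀ ν : MeasureTheory.Measure ℂ, MeasureTheory.IsLocallyFiniteMeasure ν → (∀ z : ℂ, ν {z} = 0) → Literature.Analysis.FunctionSpaces.IsPoissonPointProcess ν (Pois ν)) → let S : Literature.Analysis.FunctionSpaces.PointConfig ℂ → ℂ → Set ℂ := fun ω c => (ω : Set ℂ) ∩ Metric.sphere c (Metric.infDist c (ω : Set ℂ)); let vor : Literature.Analysis.FunctionSpaces.PointConfig ℂ → SimpleGraph ℂ := fun ω => SimpleGraph.fromRel fun c c' => 3 ≤ (S ω c).encard ∧ 3 ≤ (S ω c').encard ∧ (S ω c ∩ S ω c').encard = 2; let μ : ENNReal := essSup (fun ω => Filter.limsup (fun n : ℕ => (⨆ c : Metric.closedBall (0 : ℂ) 1, (Literature.Probability.RandomPlanarGeometry.SAW.sawCount (vor ω) (c : ℂ) n : ENNReal)) ^ (1 / (n : ℝ))) Filter.atTop) (Pois MeasureTheory.volume); let xc : ℝ := (μ.toReal)⁻¹; let near : Literature.Analysis.FunctionSpaces.PointConfig ℂ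 → Set ℂ → ℂ → ℂ := fun ω Ω z => Classical.epsilon fun v : ℂ => v ∈ Literature.Probability.RandomPlanarGeometry.SAW.embMeshDomain (vor ω) id Ω 1 ∧ ∀ w ∈ Literature.Probability.RandomPlanarGeometry.SAW.embMeshDomain (vor ω) id Ω 1, dist v z ≤ dist w z; let intens : (ℂ → ℝ) → ℝ → MeasureTheory.Measure ℂ := fun ρ δ => ENNReal.ofReal (δ⁻¹ ^ 2) • MeasureTheory.volume.withDensity fun z => ENNReal.ofReal (ρ z); let qlaw : Literature.Probability.RandomPlanarGeometry.DobrushinDomain → Literature.Analysis.FunctionSpaces.PointConfig ℂ → MeasureTheory.Measure (Literature.Probability.RandomPlanarGeometry.CurveClass ℂ) := fun D ω => (Literature.Probability.RandomPlanarGeometry.SAW.embLaw (vor ω) id D.carrier 1 xc (near ω D.carrier (D.pt 0)) (near ω D.carrier (D.pt 1))).map fun γ => γ.curve; let Q : (ℂ → ℝ) → Literature.Probability.RandomPlanarGeometry.DobrushinDomain → ℝ → MeasureTheory.Measure (Literature.Probability.RandomPlanarGeometry.CurveClass ℂ) := fun ρ D δ => (Pois (intens ρ δ)).bind (qlaw D);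 ∀ (D D' : Literature.Probability.RandomPlanarGeometry.DobrushinDomain) (g : Literature.Probability.RandomPlanarGeometry.ConformalEquiv D.carrier D'.carrier) (Φ : C(ℂ, ℂ)), g.HasBoundaryValue (D.pt 0) (D'.pt 0) → g.HasBoundaryValue (D.pt 1) (D'.pt 1) → Set.EqOn Φ g D.carrier → ∀ f : BoundedContinuousFunction (Literature.Probability.RandomPlanarGeometry.CurveClass ℂ) ℝ, Filter.Tendsto (fun δ => (∫ x, f x ∂((Q (fun _ => 1) D δ).map (Literature.Probability.RandomPlanarGeometry.CurveClass.map Φ))) - ∫ x, f x ∂(Q (fun w => 1 + Set.indicator D'.carrier (fun w => ‖deriv (fun z => g.symm z) w‖ ^ 2 - 1) w) D' δ)) (nhdsWithin 0 (Set.Ioi 0)) (nhds 0)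

/-- item stmt-CriticalPhenomena-16050 · crux · rank 7 · open · by planner
why it might fail: Restriction passage needs uniform control of P_δ[range ⊆ cl D″] across an ε-hull sandwich (continuity of the LIMIT's hull-avoidance probabilities, only after simplicity); DU must apply to ρ_g = |(g⁻¹)′|², unbounded near a rough ∂D; endpoint conventions must match under Φ.
sources: LawlerSchrammWerner2003Restriction, LawlerSchrammWerner2004SAW, Kingman1993, BenjaminiSchramm1998, Literature.Probability.RandomPlanarGeometry.IsSLECurve.map_eq_holds, Literature.Probability.RandomPlanarGeometry.LawlerSchrammWerner2003_holds
[crux] glue WITH content (rev 4; replaces PVIdentification + the inert PVRestriction):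
LSWHullCharacterisation (written out) → DensityUniversality → QuenchedLimit → PVTightSimple →
MetricBlindness → PVConvergence (written out; = stmt-CriticalPhenomena-6943 by Iff.rfl). Subsequence
transport (MetricBlindness + DensityUniversality applied to ρ_g = |(g⁻¹)′|²) makes D ↦ lim Q_D a
chordal conformally covariant family; hull restriction from the EXACT quenched restriction identity
on induced Voronoi subgraphs (LSW04 §3.4.5), commuted with the environment average by QuenchedLimit
and passed to the limit by an ε-hull SANDWICH + portmanteau (not by a continuity-set hypothesis on
the staying event — that rev ≤ 3 formulation was inert, refuter g42-21 on stmt-6942); PVTightSimple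
gives simplicity/IsChordal; the hull characterisation identifies SLE_(8/3); IsSLECurve.map_eq_holds
upgrades subsequential to full convergence. [deps: DensityUniversality, QuenchedLimit,
PVTightSimple, MetricBlindness, LSWHullCharacterisation, PVConvergence] [difficulty: XL] -/
@[route_item "route-CriticalPhenomena-SAWPoissonHoneycomb", crux]
def PVLimitIdentification : Prop :=
  (∀ P : Literature.Probability.RandomPlanarGeometry.ChordalFamily, P.IsChordal → P.IsConformallyCovariant → P.IsHullRestriction → P.IsCarriedBySimpleCurves → ∀ D : Literature.Probability.RandomPlanarGeometry.DobrushinDomain, Literature.Probability.RandomPlanarGeometry.IsSLELaw ((8 : NNReal) / 3) D (P D)) → DensityUniversality → QuenchedLimit → PVTightSimple → MetricBlindness → ∀ (Pois : MeasureTheory.Measure ℂ → MeasureTheory.Measure (Literature.Analysis.FunctionSpaces.PointConfig ℂ)), (∀ ν : MeasureTheory.Measure ℂ, MeasureTheory.IsLocallyFiniteMeasure ν → (∀ z : ℂ, ν {z} = 0) → Literature.Analysis.FunctionSpaces.IsPoissonPointProcess ν (Pois ν)) → let S : Literature.Analysis.FunctionSpaces.PointConfig ℂ → ℂ → Set ℂ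 := fun ω c => (ω : Set ℂ) ∩ Metric.sphere c (Metric.infDist c (ω : Set ℂ)); let vor : Literature.Analysis.FunctionSpaces.PointConfig ℂ → SimpleGraph ℂ := fun ω => SimpleGraph.fromRel fun c c' => 3 ≤ (S ω c).encard ∧ 3 ≤ (S ω c').encard ∧ (S ω c ∩ S ω c').encard = 2; let μ : ENNReal := essSup (fun ω => Filter.limsup (fun n : ℕ => (⨆ c : Metric.closedBall (0 : ℂ) 1, (Literature.Probability.RandomPlanarGeometry.SAW.sawCount (vor ω) (c : ℂ) n : ENNReal)) ^ (1 / (n : ℝ))) Filter.atTop) (Pois MeasureTheory.volume); let xc : ℝ := (μ.toReal)⁻¹; let near : Literature.Analysis.FunctionSpaces.PointConfig ℂ → Set ℂ → ℂ → ℂ := fun ω Ω z => Classical.epsilon fun v : ℂ => v ∈ Literature.Probability.RandomPlanarGeometry.SAW.embMeshDomain (vor ω) id Ω 1 ∧ ∀ w ∈ Literature.Probability.RandomPlanarGeometry.SAW.embMeshDomain (vor ω) id Ω 1, dist v z ≤ dist w z; let intens : (ℂ → ℝ) → ℝ → MeasureTheory.Measure ℂ := fun ρ δ => ENNReal.ofReal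 (δ⁻¹ ^ 2) • MeasureTheory.volume.withDensity fun z => ENNReal.ofReal (ρ z); let qlaw : Literature.Probability.RandomPlanarGeometry.DobrushinDomain → Literature.Analysis.FunctionSpaces.PointConfig ℂ → MeasureTheory.Measure (Literature.Probability.RandomPlanarGeometry.CurveClass ℂ) := fun D ω => (Literature.Probability.RandomPlanarGeometry.SAW.embLaw (vor ω) id D.carrier 1 xc (near ω D.carrier (D.pt 0)) (near ω D.carrier (D.pt 1))).map fun γ => γ.curve; let Q : (ℂ → ℝ) → Literature.Probability.RandomPlanarGeometry.DobrushinDomain → ℝ → MeasureTheory.Measure (Literature.Probability.RandomPlanarGeometry.CurveClass ℂ) := fun ρ D δ => (Pois (intens ρ δ)).bind (qlaw D); ∀ D : Literature.Probability.RandomPlanarGeometry.DobrushinDomain, ∃ Γ : (NNReal → ℝ) → Literature.Probability.RandomPlanarGeometry.CurveClass ℂ, Literature.Probability.RandomPlanarGeometry.IsSLECurve ((8 : NNReal) / 3) D Γ ∧ Literature.Probability.RandomPlanarGeometry.TendstoLaw (fun (_ : ℝ) (x : Literature.Probability.RandomPlanarGeometry.CurveClass ℂ) => x) (Q (fun _ =>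 1) D) Γ Literature.Probability.Process.preWienerMeasure

/-- item stmt-CriticalPhenomena-16051 · crux · rank 8 · open · by planner
why it might fail: Irrefutable short of ¬SAWScalingLimit (HexTransfer.Negative §2 accounting), but possibly unprovable by any substrate-blind argument: it is ℤ² ↔ Poisson-honeycomb universality given (PV), with Beffara's embedding-modulus caveat for ℤ² inside; no mechanism offered.
sources: LawlerSchrammWerner2004SAW, Beffara2008, GlazmanManolescu2019, KennedyLawler2013, route-CriticalPhenomena-SAWPoissonSubstrate
[crux] bridge (rev 4 split): PVConvergence (written out; = stmt-CriticalPhenomena-6943) →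
SAWScalingLimit — the annealed Poisson-honeycomb limit theorem suffices for the δℤ² conjunct.
Content = substrate universality given (PV); its refutable strengthening SubstrateUniversality
(stmt-CriticalPhenomena-6937) + the two-ε transfer are route SAWPoissonSubstrate, and a proof there
closes this item in two lines (shared decls have identical bodies). [deps: PVConvergence]
[difficulty: open-problem] -/
@[route_item "route-CriticalPhenomena-SAWPoissonHoneycomb", crux]
def PVTransfer : Prop :=
  (∀ (Pois : MeasureTheory.Measure ℂ → MeasureTheory.Measure (Literature.Analysis.FunctionSpaces.PointConfig ℂ)), (∀ ν : MeasureTheory.Measure ℂ, MeasureTheory.IsLocallyFiniteMeasure ν → (∀ z : ℂ, ν {z} = 0) → Literature.Analysis.FunctionSpaces.IsPoissonPointProcess ν (Pois ν)) → let S : Literature.Analysis.FunctionSpaces.PointConfig ℂ → ℂ → Set ℂ := fun ω c => (ω : Set ℂ) ∩ Metric.sphere c (Metric.infDist c (ω : Set ℂ)); let vor : Literature.Analysis.FunctionSpaces.PointConfig ℂ → SimpleGraph ℂ := fun ω => SimpleGraph.fromRel fun c c' => 3 ≤ (S ω c).encard ∧ 3 ≤ (S ω c').encard ∧ (S ω c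 ∩ S ω c').encard = 2; let μ : ENNReal := essSup (fun ω => Filter.limsup (fun n : ℕ => (⨆ c : Metric.closedBall (0 : ℂ) 1, (Literature.Probability.RandomPlanarGeometry.SAW.sawCount (vor ω) (c : ℂ) n : ENNReal)) ^ (1 / (n : ℝ))) Filter.atTop) (Pois MeasureTheory.volume); let xc : ℝ := (μ.toReal)⁻¹; let near : Literature.Analysis.FunctionSpaces.PointConfig ℂ → Set ℂ → ℂ → ℂ := fun ω Ω z => Classical.epsilon fun v : ℂ => v ∈ Literature.Probability.RandomPlanarGeometry.SAW.embMeshDomain (vor ω) id Ω 1 ∧ ∀ w ∈ Literature.Probability.RandomPlanarGeometry.SAW.embMeshDomain (vor ω) id Ω 1, dist v z ≤ dist w z; let intens : (ℂ → ℝ) → ℝ → MeasureTheory.Measure ℂ := fun ρ δ => ENNReal.ofReal (δ⁻¹ ^ 2) • MeasureTheory.volume.withDensity fun z => ENNReal.ofReal (ρ z); let qlaw : Literature.Probability.RandomPlanarGeometry.DobrushinDomain → Literature.Analysis.FunctionSpaces.PointConfig ℂ → MeasureTheory.Measure (Literature.Probability.RandomPlanarGeometry.CurveClass ℂ) := fun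 D ω => (Literature.Probability.RandomPlanarGeometry.SAW.embLaw (vor ω) id D.carrier 1 xc (near ω D.carrier (D.pt 0)) (near ω D.carrier (D.pt 1))).map fun γ => γ.curve; let Q : (ℂ → ℝ) → Literature.Probability.RandomPlanarGeometry.DobrushinDomain → ℝ → MeasureTheory.Measure (Literature.Probability.RandomPlanarGeometry.CurveClass ℂ) := fun ρ D δ => (Pois (intens ρ δ)).bind (qlaw D); ∀ D : Literature.Probability.RandomPlanarGeometry.DobrushinDomain, ∃ Γ : (NNReal → ℝ) → Literature.Probability.RandomPlanarGeometry.CurveClass ℂ, Literature.Probability.RandomPlanarGeometry.IsSLECurve ((8 : NNReal) / 3) D Γ ∧ Literature.Probability.RandomPlanarGeometry.TendstoLaw (fun (_ : ℝ) (x : Literature.Probability.RandomPlanarGeometry.CurveClass ℂ) => x) (Q (fun _ => 1) D) Γ Literature.Probability.Process.preWienerMeasure) → SAWScalingLimit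

/-- item stmt-CriticalPhenomena-6941 · crux (kind.auto-crux: conjecture-grade) · rank 9 · open · by planner
why it might fail: Provable now: two sorry-free candidate proofs are attached (LSWHull.lean, refuter g42-21; SPHHull.lean, grounder g13-40; rc 0, standard axioms). It fails only if the tree's LSW03 argument needed restriction beyond HULL subdomains — it does not (IsRestriction enters only via isHullRestriction).
sources: LawlerSchrammWerner2003Restriction, Literature.Probability.RandomPlanarGeometry.LawlerSchrammWerner2003_holds, Literature.Probability.RandomPlanarGeometry.LawlerSchrammWerner2003_unique_holds
[support] hull form of the Lawler–Schramm–Werner characterisation in the tree's vocabulary: a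
chordal, conformally covariant family with restriction over HULL subdomains
(MarkedDomain.IsHullSubdomain: D ∖ D′ away from both marked points — LSW03's hulls bounded and
bounded away from 0) carried by simple curves is chordal SLE_(8/3) in every domain. Provable now by
the proof of Literature.Probability.RandomPlanarGeometry.LawlerSchrammWerner2003_holds (which only
uses IsRestriction through IsRestriction.isHullRestriction) with
LawlerSchrammWerner2003_unique_holds. [difficulty: provable-now] -/
@[route_item "route-CriticalPhenomena-SAWPoissonHoneycomb", crux]
def LSWHullCharacterisation : Prop :=
  ∀ P : Literature.Probability.RandomPlanarGeometry.ChordalFamily, P.IsChordal → P.IsConformallyCovariant → P.IsHullRestriction → P.IsCarriedBySimpleCurves → ∀ D : Literature.Probability.RandomPlanarGeometry.DobrushinDomain, Literature.Probability.RandomPlanarGeometry.IsSLELaw ((8 : NNReal) / 3) D (P D)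

/-- item stmt-CriticalPhenomena-6943 · support · rank 9 · open · by planner
sources: LawlerSchrammWerner2004SAW Prediction 1, BenjaminiSchramm1998
[support] (PV) the annealed critical Poisson-honeycomb SAW law in every Dobrushin domain converges
in law (TendstoLaw, identity variable) to a chordal SLE_(8/3) curve as δ → 0+; the comparison family
Q that instantiates SAWHexUniversality.TransferShape (stmt-CriticalPhenomena-0802) for this route.
Closed via PVIdentification. [difficulty: open-problem] -/
@[route_item "route-CriticalPhenomena-SAWPoissonHoneycomb"]
def PVConvergence : Prop :=
  ∀ (Pois : MeasureTheory.Measure ℂ → MeasureTheory.Measure (Literature.Analysis.FunctionSpaces.PointConfig ℂ)), (∀ ν : MeasureTheory.Measure ℂ, MeasureTheory.IsLocallyFiniteMeasure ν → (∀ z : ℂ, ν {z} = 0) → Literature.Analysis.FunctionSpaces.IsPoissonPointProcess ν (Pois ν)) → let S : Literature.Analysis.FunctionSpaces.PointConfig ℂ → ℂ → Set ℂ := fun ω c => (ω : Set ℂ) ∩ Metric.sphere c (Metric.infDist c (ω : Set ℂ)); let vor : Literature.Analysis.FunctionSpaces.PointConfig ℂ → SimpleGraph ℂ := fun ω => SimpleGraph.fromRel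 fun c c' => 3 ≤ (S ω c).encard ∧ 3 ≤ (S ω c').encard ∧ (S ω c ∩ S ω c').encard = 2; let μ : ENNReal := essSup (fun ω => Filter.limsup (fun n : ℕ => (⨆ c : Metric.closedBall (0 : ℂ) 1, (Literature.Probability.RandomPlanarGeometry.SAW.sawCount (vor ω) (c : ℂ) n : ENNReal)) ^ (1 / (n : ℝ))) Filter.atTop) (Pois MeasureTheory.volume); let xc : ℝ := (μ.toReal)⁻¹; let near : Literature.Analysis.FunctionSpaces.PointConfig ℂ → Set ℂ → ℂ → ℂ := fun ω Ω z => Classical.epsilon fun v : ℂ => v ∈ Literature.Probability.RandomPlanarGeometry.SAW.embMeshDomain (vor ω) id Ω 1 ∧ ∀ w ∈ Literature.Probability.RandomPlanarGeometry.SAW.embMeshDomain (vor ω) id Ω 1, dist v z ≤ dist w z; let intens : (ℂ → ℝ) → ℝ → MeasureTheory.Measure ℂ := fun ρ δ => ENNReal.ofReal (δ⁻¹ ^ 2) • MeasureTheory.volume.withDensity fun z => ENNReal.ofReal (ρ z); let qlaw : Literature.Probability.RandomPlanarGeometry.DobrushinDomain → Literature.Analysis.FunctionSpaces.PointConfig ℂ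 → MeasureTheory.Measure (Literature.Probability.RandomPlanarGeometry.CurveClass ℂ) := fun D ω => (Literature.Probability.RandomPlanarGeometry.SAW.embLaw (vor ω) id D.carrier 1 xc (near ω D.carrier (D.pt 0)) (near ω D.carrier (D.pt 1))).map fun γ => γ.curve; let Q : (ℂ → ℝ) → Literature.Probability.RandomPlanarGeometry.DobrushinDomain → ℝ → MeasureTheory.Measure (Literature.Probability.RandomPlanarGeometry.CurveClass ℂ) := fun ρ D δ => (Pois (intens ρ δ)).bind (qlaw D); ∀ D : Literature.Probability.RandomPlanarGeometry.DobrushinDomain, ∃ Γ : (NNReal → ℝ) → Literature.Probability.RandomPlanarGeometry.CurveClass ℂ, Literature.Probability.RandomPlanarGeometry.IsSLECurve ((8 : NNReal) / 3) D Γ ∧ Literature.Probability.RandomPlanarGeometry.TendstoLaw (fun (_ : ℝ) (x : Literature.Probability.RandomPlanarGeometry.CurveClass ℂ) => x) (Q (fun _ => 1) D) Γ Literature.Probability.Process.preWienerMeasure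

-- earlier Assembly (stmt-CriticalPhenomena-16047, replaced 2026-08-16T17:12:13Z -> stmt-CriticalPhenomena-16049): retired by None — DensityUniversality → QuenchedLimit → PVTightSimple → MetricBlindness → LSWHullCharacterisation → SAWScalingLimit
-- earlier Assembly (stmt-CriticalPhenomena-6946, replaced 2026-08-16T17:11:44Z -> stmt-CriticalPhenomena-16047): retired by None — LSWHullCharacterisation → PVRestriction → DensityUniversality → SubstrateUniversality → QuenchedLimit → PVTightSimple → MetricBlindness → SAWScalingLimit
/-- item stmt-CriticalPhenomena-16049 · assembly · rank 1 · open · by planner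
sources: LawlerSchrammWerner2003Restriction, LawlerSchrammWerner2004SAW, BenjaminiSchramm1998
[assembly] rev 5 frame (route-choice split): DensityUniversality → QuenchedLimit → PVTightSimple →
MetricBlindness → LSWHullCharacterisation → PVLimitIdentification → PVTransfer → SAWScalingLimit;
pure logic `fun hDU hQ hT hMB hLSW hId hPT => hPT (hId hLSW hDU hQ hT hMB)`; not a hypothesis of
`closes`. -/
@[route_item "route-CriticalPhenomena-SAWPoissonHoneycomb"]
def Assembly : Prop :=
  DensityUniversality → QuenchedLimit → PVTightSimple → MetricBlindness → LSWHullCharacterisation → PVLimitIdentification → PVTransfer → SAWScalingLimit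

/-! D-0027 §2.1 — DECIDING THEOREM (planner-authored via `route open/edit --closes-file`; by planner-rchoice-CriticalPhenomena-SAWPoissonHo-11b4d6dd-0 2026-08-16T17:12:13Z):
its hypotheses are this route's items and its conclusion the sub-problem Statement (glue_lint), and it elaborates with this file. -/

@[closes "route-CriticalPhenomena-SAWPoissonHoneycomb"] theorem closes (hDU : DensityUniversality) (hQ : QuenchedLimit) (hT : PVTightSimple)
    (hMB : MetricBlindness) (hLSW : LSWHullCharacterisation) (hId : PVLimitIdentification)
    (hPT : PVTransfer) : _root_.SAWScalingLimit :=
  -- rev 4 (route-choice split): `PVLimitIdentification` is the identification theorem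
  -- `LSWHullCharacterisation → DensityUniversality → QuenchedLimit → PVTightSimple → MetricBlindness → PVConvergence`
  -- (antecedent and conclusion written out, definitionally the route decls), and `PVTransfer` is the bridge
  -- `PVConvergence → SAWScalingLimit`; the transfer half (SubstrateUniversality + two-ε) is route SAWPoissonSubstrate.
  hPT (hId hLSW hDU hQ hT hMB)

end Summit.CriticalPhenomena.SAWScalingLimit.Theses.SAWPoissonHoneycomb
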